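import Summits.BirchSwinnertonDyer.BirchSwinnertonDyer.Theorems.PrintX11aUpperNonSurjThreeBodyOfFacts
import Summits.BirchSwinnertonDyer.BirchSwinnertonDyer.Theorems.ErratumRoadFiveNonSurjCornerTwinKatoFactsContra
import Literature.NumberTheory.EllipticCurves.Kato2004.IwasawaCohomologyExistsProofs
import Literature.NumberTheory.EllipticCurves.AnalyticRankModularityProofs
import Literature.NumberTheory.EllipticCurves.ModularParametrizationProofs
import Literature.NumberTheory.EllipticCurves.ModularParametrizationHoldsProofs
import HarnessLib

/-!
# Route `PrintX11a`, crux U3 `UpperNonSurjThree` (item stmt-BirchSwinnertonDyer-20613): the BODY of the crux from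
# TWELVE print-exact named facts — the §17.13 inputs re-keyed on the contragredient twins V′ ∕ VI′ ∕ XI′, and the
# three conjuncts of the fact bundle that are THEOREMS of the tree discharged

Cell `bsd-print-x11a`, width seat bsd-line-x11a-p2 g3 (`--supports stmt-BirchSwinnertonDyer-20613 --as helper`). Theorems
only; Theses-free; BSD is not proved by any of this; nothing is asserted about any curve; item 20613 does not close by this file.

State before this file. The lead's `Theorems.upperNonSurjThree_of_katoTwinFactsFiveAn` (p617007) and this lineage's
Theses-free turnkey `ClassX11a.upperNonSurjThree_body_of_facts` (p616233) give the body of U3,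
`∀ W p, ClassX11a W p → ¬Surj W p → p = 3 → Typed.MissingUpperBoundAt W p`, from FOURTEEN displayed hypotheses: thirteen
conjuncts of K2's bundle `KatoTwinFactsFiveAn` (item 19949) and Mazur 1978 Cor. 4.1. Three of those conjuncts are the
γ-keyed Kato §17.13 construction facts `Kato2004.exists_multDivisibilityInputs_{nonsplit,split,fine}`, which carry the
referee's provisional flag (ARM-P R-48: stronger than print by `ι`); their print-exact contragredient twins
`…_{nonsplit,split,fine}_contra` and the re-keyed μ-transfer `X11b.multDivisibilityAt_of_katoFacts_of_muAnZeroAt_contra`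
are in the tree (stepL p616984). Three further conjuncts are THEOREMS of the tree: (17) `Kato2004.nonempty_iwasawaH1Data`
(`Kato2004.nonempty_iwasawaH1Data_holds`), (5) `hasEntireLFunction_rat` and (7) `nonempty_modularParametrizationData`, both
from (6) `exists_isNewformOf` (`WeierstrassCurve.hasEntireLFunction_rat_of_exists_isNewformOf`,
`nonempty_modularParametrizationData_of_modularity` with the discharged leaf `IsNewformOf.exists_maninConstant_modularDegree_holds`).

This file. `ClassX11a.upperNonSurjThree_body_of_contraFacts`: the body of U3 from TWELVE named facts, none γ-keyed —
Stein–Wuthrich 2013 Thm. 6.1 ×2 (`hJs`, `hJn`), Gross–Zagier–Kolyvagin (`hGZK`), Greenberg–Stevens ∕ Kobayashi (`hGS`),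
Kato 12.4 (`h12`), modularity (`hnf`), Kato §17.13 contragredient packages V′ ∕ VI′ ∕ XI′ (`hns'`, `hsp'`, `hfine'`),
Greenberg 1999 Thm. 1.5 (`h15`), Wuthrich 2014 Cor. 18 (`h18`), Mazur 1978 Cor. 4.1 (`hMz`). Per pair the count is
sharper: `ClassX11a.missingUpperBoundAt_three_of_not_surj_of_contraFacts` demands Greenberg–Stevens ONLY at a split `3`
(§2 is the K2 engine `X11b.missingUpperBoundAt_of_multDivisibilityAt_of_analyticRank_eq_zero` with the exceptional-zero
formula asked only in the split branch and modularity entering once, through `hnf`), so at a NON-split pair eleven facts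
suffice. The analytic input is this lineage's THEOREM `MultThreeMuAn.muAnZeroAt_three_of_mult_of_irr` (Greenberg's analytic
`μ₃ = 0` at a multiplicative `3` for every irreducible `E[3]`, modulo Mazur's fact), §1.
For the planner: a U3-specific input item (or a contra-keyed bundle) with exactly these twelve conjuncts makes the glue
`obtain ⟨…⟩ := h; exact ClassX11a.upperNonSurjThree_body_of_contraFacts …` one line; γ-keyed consumers keep p616233.
References (locators only): [cite: Kato2004Asterisque, Thm. 12.4 (p. 221), §17.13 (pp. 279–280)]
[cite: SteinWuthrich2013, Thm. 6.1 (p. 20)] [cite: Kobayashi2006DocMath, Cor. 4.2 (p. 575)] [cite: Mazur1978, Cor. 4.1]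
[cite: GreenbergLNM1716, §1 Conj. 1.11 (p. 58), Thm. 1.5 (p. 61)] [cite: Wuthrich2014, Cor. 18 (p. 398)]
[cite: DiamondShurman2005, Thm. 8.8.3] [cite: BCDTJAMS2001, Thm. A].
-/

set_option autoImplicit false

noncomputable section

open scoped Classical MatrixGroups ModularForm

open CongruenceSubgroup WeierstrassCurve
  Literature.NumberTheory.EllipticCurves
  Literature.NumberTheory.EllipticCurves.ModularForms
  Literature.NumberTheory.EllipticCurves.Rank1Residual
  Literature.NumberTheory.EllipticCurves.Rank1Residual.Typed
  Literature.NumberTheory.EllipticCurves.Wuthrich2014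
  Literature.NumberTheory.EllipticCurves.SteinWuthrich2013
  Literature.NumberTheory.EllipticCurves.Greenberg1999
  Literature.NumberTheory.EllipticCurves.Kato2004
  Summit.BirchSwinnertonDyer.Rank1Residual
  Summit.BirchSwinnertonDyer.Rank1Residual.RankZeroHeightFree
  Summit.BirchSwinnertonDyer.BirchSwinnertonDyer.Theorems

/-! ### §1 The typed divisibility at an odd-image pair `(W, 3)` from the contragredient packages and `μ₃^an = 0` -/

namespace Summit.BirchSwinnertonDyer.Rank1Residual.X11b

/-- **`X11b.MultDivisibilityAt W 3` at a multiplicative `3` with `E[3]` irreducible and `ρ̄_{E,3}` NOT onto, from EIGHT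
named facts**: Kato 12.4, modularity, the print-exact contragredient §17.13 packages V′ ∕ VI′ ∕ XI′, Greenberg 1.5,
Wuthrich Cor. 18 and Mazur Cor. 4.1 — the stepL re-keyed μ-transfer `multDivisibilityAt_of_katoFacts_of_muAnZeroAt_contra`
with `𝐇¹_Γ(T_pW)` supplied by the tree theorem `Kato2004.nonempty_iwasawaH1Data_holds` and the analytic certificate
`X11a.MuAnZeroAt W 3` by `MultThreeMuAn.muAnZeroAt_three_of_mult_of_irr`. CONDITIONAL; nothing booked.
[cite: Kato2004Asterisque, Thm. 12.4 (p. 221), §17.13 (pp. 279–280)] [cite: Wuthrich2014, Cor. 18 (p. 398)]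
[cite: GreenbergLNM1716, §1 Conj. 1.11 (p. 58), Thm. 1.5 (p. 61)] [cite: Mazur1978, Cor. 4.1] -/
theorem multDivisibilityAt_three_of_not_surj_of_contraFacts
    (h12 : thm12_4) (hnf : exists_isNewformOf)
    (hns' : exists_multDivisibilityInputs_nonsplit_contra) (hsp' : exists_multDivisibilityInputs_split_contra)
    (h15 : thm15_isTorsion_multiplicative_rat)
    (h18 : corollary18_padicLFunction_mem_iwasawaAlgebra_multiplicative)
    (hfine' : exists_multDivisibilityInputs_fine_contra) (hMz : mazur_not_dvd_maninConstant_of_odd)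
    (W : WeierstrassCurve ℚ) [W.IsElliptic] [W.IsGloballyMinimal]
    (hmult : Mult W 3) (hirr : Irr W 3) (hnsurj : ¬ Surj W 3) : MultDivisibilityAt W 3 :=
  haveI : Fact (Nat.Prime 3) := ⟨Nat.prime_three⟩
  multDivisibilityAt_of_katoFacts_of_muAnZeroAt_contra nonempty_iwasawaH1Data_holds h12 hnf hns' hsp' h15 h18 hfine'
    W 3 (by decide) hmult hirr hnsurj (MultThreeMuAn.muAnZeroAt_three_of_mult_of_irr hMz W hmult hirr)

/-! ### §2 The rank-`0` engine with Greenberg–Stevens asked only at a split prime and modularity entering once -/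

/-- **The K2 rank-`0` engine `missingUpperBoundAt_of_multDivisibilityAt_of_analyticRank_eq_zero`, sharpened in its
hypotheses only**: for `W/ℚ` globally minimal, `p` an ODD multiplicative prime with `ord_{s=1} L(E,s) = 0`,
`X11b.MultDivisibilityAt W p ⟹ Typed.MissingUpperBoundAt W p`, granted Stein–Wuthrich 2013 Thm. 6.1 (`hJs` ∕ `hJn`),
Gross–Zagier–Kolyvagin (`hGZK`), modularity as `exists_isNewformOf` ALONE (the entire `L`-function and the parametrisation
datum are derived from `hnf` by tree theorems) and the exceptional-zero formula `hGS` ONLY IF the reduction at `p` is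
split (the non-split branch never reads it). Proof = the engine's, line by line. [cite: SteinWuthrich2013, Thm. 6.1 (p. 20) and §4.2]
[cite: Kobayashi2006DocMath, Cor. 4.2 (p. 575)] [cite: Miller2011LMS, Def. 1.1 and §1] -/
theorem missingUpperBoundAt_of_multDivisibilityAt_of_analyticRank_eq_zero_of_newform
    (hJs : thm61_splitMultiplicative) (hJn : thm61_nonsplitMultiplicative)
    (hGZK : rank_eq_analyticRank_of_analyticRank_le_one) (hnf : exists_isNewformOf)
    (W : WeierstrassCurve ℚ) [W.IsElliptic] [W.IsGloballyMinimal] (p : ℕ) [Fact p.Prime]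
    (hGS : W.HasSplitMultiplicativeReductionAtPrime p → greenberg_stevens (W := W) (p := p))
    (hp : p ≠ 2) (hmult : W.HasMultiplicativeReductionAtPrime p) (hr : W.analyticRank = 0)
    (hdiv : MultDivisibilityAt W p) : Typed.MissingUpperBoundAt W p := by
  have hmod : hasEntireLFunction_rat := WeierstrassCurve.hasEntireLFunction_rat_of_exists_isNewformOf hnf
  have hpar : nonempty_modularParametrizationData :=
    nonempty_modularParametrizationData_of_modularity hnf IsNewformOf.exists_maninConstant_modularDegree_holds
  obtain ⟨κ, hκ, γ, hγ, hγ'⟩ := exists_isCyclotomic_isTopGenerator_isCyclotomicVariable_holds p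
  obtain ⟨D⟩ := W.nonempty_selmerDualData_holds κ γ hγ
  haveI : NeZero (W.conductorNorm ℤ) := ⟨(W.conductorNorm_pos_holds).ne'⟩
  obtain ⟨Dm⟩ := hpar W
  obtain ⟨ϖ, hϖpos, hϖ, -⟩ := Dm.exists_rat_mul_realPeriodRat_eq_plusPeriod
  obtain ⟨hX, hnsp, hsp⟩ := hdiv hκ hγ hγ' Dm.isNewformOf D ϖ hϖpos.ne' hϖ
  have hL1 : W.entireLFunction 1 ≠ 0 := (W.analyticRank_eq_zero_iff_holds (hmod W)).1 hr
  by_cases hsplit : W.HasSplitMultiplicativeReductionAtPrime p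
  · obtain ⟨L, hL⟩ := exists_isSplitMultPAdicLFunctionOf hsplit Dm.isNewformOf
    obtain ⟨Dq⟩ := (nonempty_tateParameterData_iff_holds (W := W) (p := p)).mpr hsplit
    exact missingUpperBoundAt_of_padicValRat_le_rank_zero W p hL1 hGZK
      (le_padicValRat_of_split_divisibility_rankZero hJs hGZK hmod W p (hGS hsplit) LInvariant_ne_zero_holds hp
        hr Dq hκ hγ hγ' Dm.isNewformOf D ϖ hϖpos.ne' hϖ L hL hX (hsp hsplit L hL))
  · obtain ⟨L, hL⟩ := exists_isMultPAdicLFunctionOf_neg_one_of_nonsplit Dm.isNewformOf hmult hsplit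
    obtain ⟨q, ⟨hq0, hq1, hqj⟩, -⟩ := existsUnique_tateJ_eq_of_one_lt_norm
      (one_lt_norm_j_of_hasMultiplicativeReductionAtPrime (W := W) (p := p) hmult)
    exact missingUpperBoundAt_of_padicValRat_le_rank_zero W p hL1 hGZK
      (le_padicValRat_of_nonsplit_divisibility_rankZero hJn hGZK hmod W p hp hr hmult hsplit hq0 hq1 hqj
        hκ hγ hγ' Dm.isNewformOf D ϖ hϖpos.ne' hϖ L hL hX (hnsp hsplit L hL))

end Summit.BirchSwinnertonDyer.Rank1Residual.X11b

/-! ### §3 The body of U3 from twelve print-exact named facts -/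

namespace Summit.BirchSwinnertonDyer.Rank1Residual.ClassX11a

/-- **Per pair, Greenberg–Stevens only at a split `3`.** At an X11a pair `(W, 3)` (`r_an = 0`, `3 ∥ N`, `E[3]`
irreducible) with `ρ̄_{E,3}` not surjective: `ord₃ #Ш ≤ ord₃ #Ш_an` (`Typed.MissingUpperBoundAt W 3`), modulo ELEVEN named
facts plus — only when the reduction at `3` is split — the exceptional-zero formula at the pair. §1 then §2.
[cite: Kato2004Asterisque, Thm. 12.4 (p. 221), §17.13 (pp. 279–280)] [cite: SteinWuthrich2013, Thm. 6.1 (p. 20)]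
[cite: Mazur1978, Cor. 4.1] [cite: GreenbergLNM1716, §1 Conj. 1.11 (p. 58)] -/
theorem missingUpperBoundAt_three_of_not_surj_of_contraFacts
    (hJs : thm61_splitMultiplicative) (hJn : thm61_nonsplitMultiplicative)
    (hGZK : rank_eq_analyticRank_of_analyticRank_le_one) (h12 : Kato2004.thm12_4) (hnf : exists_isNewformOf)
    (hns' : Kato2004.exists_multDivisibilityInputs_nonsplit_contra)
    (hsp' : Kato2004.exists_multDivisibilityInputs_split_contra)
    (h15 : thm15_isTorsion_multiplicative_rat)
    (h18 : Wuthrich2014.corollary18_padicLFunction_mem_iwasawaAlgebra_multiplicative)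
    (hfine' : Kato2004.exists_multDivisibilityInputs_fine_contra) (hMz : mazur_not_dvd_maninConstant_of_odd)
    (W : WeierstrassCurve ℚ) [W.IsElliptic] [W.IsGloballyMinimal] [Fact (Nat.Prime 3)]
    (hGS : W.HasSplitMultiplicativeReductionAtPrime 3 → greenberg_stevens (W := W) (p := 3))
    (hX : ClassX11a W 3) (hns : ¬ Surj W 3) : Typed.MissingUpperBoundAt W 3 :=
  X11b.missingUpperBoundAt_of_multDivisibilityAt_of_analyticRank_eq_zero_of_newform hJs hJn hGZK hnf W 3 hGS hX.2.1
    hX.2.2.1 hX.1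
    (X11b.multDivisibilityAt_three_of_not_surj_of_contraFacts h12 hnf hns' hsp' h15 h18 hfine' hMz W hX.2.2.1
      hX.2.2.2.1 hns)

/-- **The body of U3 from TWELVE print-exact named facts (μ-road, whole domain, contragredient packages).** At every
X11a pair `(W, 3)` with `ρ̄_{E,3}` not surjective: `ord₃ #Ш ≤ ord₃ #Ш_an` (`Typed.MissingUpperBoundAt W 3`), modulo
Stein–Wuthrich 6.1 ×2, GZK, Greenberg–Stevens ∕ Kobayashi, Kato 12.4, modularity, Kato §17.13 V′ ∕ VI′ ∕ XI′, Greenberg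
1.5, Wuthrich Cor. 18, Mazur Cor. 4.1 — none γ-keyed; the analytic `μ₃ = 0` input is the THEOREM
`MultThreeMuAn.muAnZeroAt_three_of_mult_of_irr`. Same shape as `upperNonSurjThree_body_of_facts` (p616233) with the three
§17.13 facts swapped for their twins and conjuncts 5, 7, 17 discharged. [cite: Kato2004Asterisque, §17.13 (pp. 279–280)]
[cite: SteinWuthrich2013, Thm. 6.1 (p. 20)] [cite: Mazur1978, Cor. 4.1] [cite: GreenbergLNM1716, §1 Conj. 1.11 (p. 58)] -/
theorem upperNonSurjThree_body_of_contraFacts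
    (hJs : thm61_splitMultiplicative) (hJn : thm61_nonsplitMultiplicative)
    (hGZK : rank_eq_analyticRank_of_analyticRank_le_one)
    (hGS : ∀ (W : WeierstrassCurve ℚ) [W.IsElliptic] [W.IsGloballyMinimal] (p : ℕ) [Fact p.Prime],
      greenberg_stevens (W := W) (p := p))
    (h12 : Kato2004.thm12_4) (hnf : exists_isNewformOf)
    (hns' : Kato2004.exists_multDivisibilityInputs_nonsplit_contra)
    (hsp' : Kato2004.exists_multDivisibilityInputs_split_contra)
    (h15 : thm15_isTorsion_multiplicative_rat)
    (h18 : Wuthrich2014.corollary18_padicLFunction_mem_iwasawaAlgebra_multiplicative)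
    (hfine' : Kato2004.exists_multDivisibilityInputs_fine_contra) (hMz : mazur_not_dvd_maninConstant_of_odd) :
    ∀ (W : WeierstrassCurve ℚ) [W.IsElliptic] [W.IsGloballyMinimal] (p : ℕ) [Fact p.Prime],
      ClassX11a W p → ¬ Surj W p → p = 3 → Typed.MissingUpperBoundAt W p := by
  intro W _ _ p _ hX hns hp3
  subst hp3
  exact missingUpperBoundAt_three_of_not_surj_of_contraFacts hJs hJn hGZK h12 hnf hns' hsp' h15 h18 hfine' hMz W
    (fun _ => hGS W 3) hX hns

/-- **The γ-keyed twin with the three tree theorems discharged** — `upperNonSurjThree_body_of_facts` (p616233) minus its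
hypotheses `hmod`, `hpar` (both from `hnf` by tree theorems) and `hne` (`Kato2004.nonempty_iwasawaH1Data_holds`): the body of U3 from
the ELEVEN remaining γ-keyed conjuncts of `KatoTwinFactsFiveAn` it reads plus Mazur Cor. 4.1, for consumers that stay on
item 19949's text. [cite: Kato2004Asterisque, §17.13 (pp. 279–280)] [cite: SteinWuthrich2013, Thm. 6.1 (p. 20)]
[cite: Mazur1978, Cor. 4.1] [cite: GreenbergLNM1716, §1 Conj. 1.11 (p. 58)] -/
theorem upperNonSurjThree_body_of_facts_of_newform
    (hJs : thm61_splitMultiplicative) (hJn : thm61_nonsplitMultiplicative)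
    (hGZK : rank_eq_analyticRank_of_analyticRank_le_one)
    (hGS : ∀ (W : WeierstrassCurve ℚ) [W.IsElliptic] [W.IsGloballyMinimal] (p : ℕ) [Fact p.Prime],
      greenberg_stevens (W := W) (p := p))
    (h12 : Kato2004.thm12_4) (hnf : exists_isNewformOf)
    (hnsI : Kato2004.exists_multDivisibilityInputs_nonsplit) (hspI : Kato2004.exists_multDivisibilityInputs_split)
    (h15 : thm15_isTorsion_multiplicative_rat)
    (h18 : Wuthrich2014.corollary18_padicLFunction_mem_iwasawaAlgebra_multiplicative)
    (hfine : Kato2004.exists_multDivisibilityInputs_fine) (hMz : mazur_not_dvd_maninConstant_of_odd) :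
    ∀ (W : WeierstrassCurve ℚ) [W.IsElliptic] [W.IsGloballyMinimal] (p : ℕ) [Fact p.Prime],
      ClassX11a W p → ¬ Surj W p → p = 3 → Typed.MissingUpperBoundAt W p :=
  upperNonSurjThree_body_of_facts hJs hJn hGZK (WeierstrassCurve.hasEntireLFunction_rat_of_exists_isNewformOf hnf)
    (nonempty_modularParametrizationData_of_modularity hnf IsNewformOf.exists_maninConstant_modularDegree_holds) hGS
    Kato2004.nonempty_iwasawaH1Data_holds h12 hnsI hspI h15 h18 hfine hMz

end Summit.BirchSwinnertonDyer.Rank1Residual.ClassX11a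

end
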